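import Literature.NumberTheory.EllipticCurves.TwoDescentLocalGeneral
import HarnessLib

/-!
# The `2`-descent map at a good odd place, abstractly: even valuation of `x(P) - e₁`

Silverman, *The Arithmetic of Elliptic Curves*, Prop. X.1.4: the complete `2`-descent map
`E(K) → Kˣ/Kˣ² × Kˣ/Kˣ²`, `P ↦ (x(P) - e₁, x(P) - e₂)`, takes values in `K(S, 2) × K(S, 2)` — at a
place `v ∉ S`, i.e. with `v(e₁ - e₂) = v(e₁ - e₃) = 0` (good reduction, `v` odd), `v(x(P) - e₁)` is
even. The tree proves this over `ℚ` (`Curve24A1.even_padicValRat_sub`,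
`TwoDescentLinearConditions.even_padicValRat_descentRep`) with `padicValRat`; the argument uses only
the valuation axioms of an abstract odd place (`OddPlace F`, `TwoDescentLocalGeneral.lean`:
additivity on products and ultrametric domination), so it holds verbatim over any field carrying
such a place — in particular over the completions `ℚ_ℓ` (`padicPlace ℓ : OddPlace ℚ_[ℓ]`,
`TwoDescentLocalPadic.lean`), which is the form the local descent images need.

* `OddPlace.even_v_sub`: on `y² = (x - e₁)(x - e₂)(x - e₃)` with `y ≠ 0`, `v(e₁ - e₂) = v(e₁ - e₃) = 0`,
  `v(x - e₁)` is even (if `v(x - e₁) < 0` all three factors share its valuation and `3v = 2v(y)`; if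
  `v(x - e₁) > 0` the other two factors are units and `v(x - e₁) = 2v(y)`);
* `OddPlace.exists_even_v_twoDescentComponent`: for every point `P` of a curve with rational
  `2`-torsion, the descent component `twoDescentComponent W e₁ e₂ e₃ P` is the square class of a
  representative `r ≠ 0` with `v(r)` even (`O ↦ 1`, `T₁ ↦ (e₁ - e₂)(e₁ - e₃)`, `T₂, T₃ ↦ e₂ - e₁, e₃ - e₁`,
  `(x, y) ↦ x - e₁`).

Consumer: the descent–Selmer bridge at the completions (`TwoDescentKummerBridgeLocal.lean`): a
Selmer class has, at every good odd place, a local component of even valuation, whence its global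
components are `S`-units modulo squares. Theorems only; no named fact. Cell `bsd-monsky`.

## References

* [SilvermanAEC2009] J. H. Silverman, *The Arithmetic of Elliptic Curves*, 2nd ed., GTM 106,
  Springer 2009, Prop. X.1.4 (Complete `2`-descent) and its proof, pp. 270–271 of the held copy.
-/

noncomputable section

open WeierstrassCurve.Affine WeierstrassCurve.Affine.Point

namespace Literature.NumberTheory.EllipticCurves.TwoDescentLocal.OddPlace

variable {F : Type*} [Field F] (𝔳 : OddPlace F)

/-- **Parity of `v(x - e₁)` on `y² = (x - e₁)(x - e₂)(x - e₃)` at an odd place with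
`v(e₁ - e₂) = v(e₁ - e₃) = 0`** (Silverman AEC Prop. X.1.4, "image in `K(S,2)`", at `v ∉ S`): if
`y ≠ 0` then `v(x - e₁)` is even. [cite: SilvermanAEC2009, Prop. X.1.4] -/
theorem even_v_sub {e₁ e₂ e₃ x y : F} (h₁₂ : e₁ ≠ e₂) (h₁₃ : e₁ ≠ e₃) (hv₁₂ : 𝔳.v (e₁ - e₂) = 0)
    (hv₁₃ : 𝔳.v (e₁ - e₃) = 0) (hy : y ≠ 0) (h : y ^ 2 = (x - e₁) * (x - e₂) * (x - e₃)) :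
    Even (𝔳.v (x - e₁)) := by
  have h₀ : (x - e₁) * (x - e₂) * (x - e₃) ≠ 0 := h ▸ pow_ne_zero 2 hy
  have hx₁ : x - e₁ ≠ 0 := fun h0 => h₀ (by rw [h0, zero_mul, zero_mul])
  have hx₂ : x - e₂ ≠ 0 := fun h0 => h₀ (by rw [h0, mul_zero, zero_mul])
  have hx₃ : x - e₃ ≠ 0 := fun h0 => h₀ (by rw [h0, mul_zero])
  have he₁₂ : e₁ - e₂ ≠ 0 := sub_ne_zero.mpr h₁₂
  have he₁₃ : e₁ - e₃ ≠ 0 := sub_ne_zero.mpr h₁₃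
  have hsum : 2 * 𝔳.v y = 𝔳.v (x - e₁) + 𝔳.v (x - e₂) + 𝔳.v (x - e₃) := by
    have key := congrArg 𝔳.v h
    rw [𝔳.v_sq hy, 𝔳.v_mul (mul_ne_zero hx₁ hx₂) hx₃, 𝔳.v_mul hx₁ hx₂] at key
    exact key
  have hx₂' : x - e₂ = (x - e₁) + (e₁ - e₂) := by ring
  have hx₃' : x - e₃ = (x - e₁) + (e₁ - e₃) := by ring
  rcases lt_trichotomy (𝔳.v (x - e₁)) 0 with hlt | heq | hgt
  · have hv₂ : 𝔳.v (x - e₂) = 𝔳.v (x - e₁) := by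
      rw [hx₂']
      exact (𝔳.add_eq_left_of_lt hx₁ he₁₂ (by rw [hv₁₂]; exact hlt)).2
    have hv₃ : 𝔳.v (x - e₃) = 𝔳.v (x - e₁) := by
      rw [hx₃']
      exact (𝔳.add_eq_left_of_lt hx₁ he₁₃ (by rw [hv₁₃]; exact hlt)).2
    rw [hv₂, hv₃] at hsum
    exact ⟨𝔳.v y - 𝔳.v (x - e₁), by omega⟩
  · exact ⟨0, by rw [heq]; rfl⟩
  · have hv₂ : 𝔳.v (x - e₂) = 0 := by
      rw [hx₂', add_comm, ← hv₁₂]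
      exact (𝔳.add_eq_left_of_lt he₁₂ hx₁ (by rw [hv₁₂]; exact hgt)).2
    have hv₃ : 𝔳.v (x - e₃) = 0 := by
      rw [hx₃', add_comm, ← hv₁₃]
      exact (𝔳.add_eq_left_of_lt he₁₃ hx₁ (by rw [hv₁₃]; exact hgt)).2
    rw [hv₂, hv₃] at hsum
    exact ⟨𝔳.v y, by omega⟩

variable [CharZero F] [DecidableEq F] {W : WeierstrassCurve.Affine F} [W.IsElliptic] {e₁ e₂ e₃ : F}

/-- **The descent component at a good odd place is a square class of even valuation** (Silverman
AEC Prop. X.1.4, `δ(E(K)) ⊆ K(S,2) × K(S,2)` at `v ∉ S`): for every `P ∈ E(F)`,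
`twoDescentComponent W e₁ e₂ e₃ P = sqClass r` for some `r ≠ 0` with `v(r)` even.
[cite: SilvermanAEC2009, Prop. X.1.4] -/
theorem exists_even_v_twoDescentComponent (h : W.SplitTwoTorsion e₁ e₂ e₃)
    (hv₁₂ : 𝔳.v (e₁ - e₂) = 0) (hv₁₃ : 𝔳.v (e₁ - e₃) = 0) (P : W.Point) :
    ∃ r : F, r ≠ 0 ∧ twoDescentComponent W e₁ e₂ e₃ P = sqClass r ∧ Even (𝔳.v r) := by
  rcases P with _ | ⟨x, y, hP⟩
  · refine ⟨1, one_ne_zero, ?_, by rw [𝔳.v_one]; exact ⟨0, rfl⟩⟩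
    rw [← zero_def, twoDescentComponent_zero, ← mul_one (1 : F), sqClass_mul_self]
  by_cases hx₁ : x = e₁
  · refine ⟨(e₁ - e₂) * (e₁ - e₃), h.c_ne_zero, twoDescentComponent_some_of_eq _ hx₁, ?_⟩
    rw [𝔳.v_mul (sub_ne_zero.mpr h.ne₁₂) (sub_ne_zero.mpr h.ne₁₃), hv₁₂, hv₁₃]
    exact ⟨0, rfl⟩
  refine ⟨x - e₁, sub_ne_zero.mpr hx₁, twoDescentComponent_some_of_ne _ hx₁, ?_⟩
  have hsq := sq_eq_mul_mul_of_equation h hP.1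
  by_cases hy : y + (W.a₁ * x + W.a₃) / 2 = 0
  · -- `P` is `T₂` or `T₃`: `x - e₁ = e₂ - e₁` or `e₃ - e₁`
    rw [hy, zero_pow two_ne_zero, eq_comm, mul_eq_zero, mul_eq_zero] at hsq
    rcases hsq with (hx | hx) | hx
    · exact absurd (sub_eq_zero.mp hx) hx₁
    · rw [sub_eq_zero.mp hx, 𝔳.v_sub_comm, hv₁₂]; exact ⟨0, rfl⟩
    · rw [sub_eq_zero.mp hx, 𝔳.v_sub_comm, hv₁₃]; exact ⟨0, rfl⟩
  · exact 𝔳.even_v_sub h.ne₁₂ h.ne₁₃ hv₁₂ hv₁₃ hy hsq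

end Literature.NumberTheory.EllipticCurves.TwoDescentLocal.OddPlace

end
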